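import Literature.Computability.AlgebraicComplexity.KoszulFlatteningBorderRank
import Literature.Computability.AlgebraicComplexity.LandsbergMichalekPivots
import Literature.Computability.AlgebraicComplexity.LandsbergMichalekBinomial
import HarnessLib

/-!
# Landsberg–Michałek 2018, Thm. 1.1, Part 2: the reduced Koszul flattening of `⟨n, w, n⟩^λ` is triangular

Topic `Literature/Computability/AlgebraicComplexity`. Part 2 of the proof of Landsberg–Michałek 2018,
Thm. 1.1 (the named fact `LandsbergMichalek2018_thm_1_1` of `BorderRankMatMulSmall.lean`, discharged in
`BorderRankMatMulSmallProofs.lean`; Part 1, the border substitution, is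
`LandsbergMichalekSubstitution.lean`). Everything here is PROVED, over an arbitrary field `K`.

We work with `T = matMulTensor K (p+1) w (p+1)` (`n = p + 1`; first factor `A = K^{(p+1)×(p+1)}`,
the factor on which LM18 substitute and flatten; `R̲(⟨n,n,w⟩) = R̲(⟨n,w,n⟩)` by
`algBorderRank_matMulTensor_rotate`). For a set `λ` of first-factor cells, `T^λ = delSlices λ T` is
`T` with the slices `a ∈ λ` zeroed (LM18: `M^λ = M/U_λ`, extended by zero). The first coordinate of a
cell is read reversed (`lmIdx (x, y) = rev x + y`), so that LM18's Young diagrams become LOWER SETS of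
`Fin (p+1) × Fin (p+1)` for the product order with corner `(0, 0)` (the cell whose deletion kills a
single diagonal entry), and LM18's `g(i, j)` becomes `lmG p (x, y) = C(p−x+y, y) C(p+x−y, x)`
(`i = x + 1`, `j = y + 1`).

## Content (LM18 §3, Part 2; the triangular structure is LM16, proof of Thm. 6.1)

* `delSlices`, `lmIdx`, `lmMatrix` (the projection `φ : u^i ⊗ v_j ↦ e_{i+j−1}`, here
  `e_{(x,y)} ↦ e_{rev x + y} ∈ K^{2p+1}`), `koszulFlattening_lm_apply` (entries of the Koszul
  flattening `Λ^p K^{2p+1} ⊗ B^* → Λ^{p+1} K^{2p+1} ⊗ C` of `T^λ`: row `(P, (k', ν))`, column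
  `(S, (κ, k))`, entry `[k = k'] [(κ,ν) ∉ λ] (e_{rev κ + ν} ∧ e_S)_P`).
* `lmPivot` (`p_l`, the element of rank `ν` of `P`), `lmCol` (the column
  `σ(P, l) = (P ∖ {p_l}, 1 + p_l − l)` matched to the row `(P, l)`), `lmKey` (LM16's order on the rows,
  as the key `(p_1, …, p_l, ∞, …)` in `Lex (Fin (p+1) → ℕ)`), `lm_triangular` (**every non-zero entry
  of the column `σ(r)` is in row `r` or in a row of larger key** — LM16 p. 13), `lm_diag_ne_zero_iff`
  (the diagonal entry of `(P, l)` vanishes iff the matched cell was deleted).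
* `lmG`, `card_filter_cell_mem_le` (the number of vanishing diagonal entries is
  `≤ w Σ_{(x,y) ∈ λ} g(x,y)`: a `(p+1)`-subset with prescribed rank-`y` element `v` is determined by its
  parts below and above `v`).
* `LandsbergMichalek2018_partTwo` — **`w (p+1) C(2p+1,p+1) ≤ C(2p,p) R̲(T^λ) + w Σ_λ g`** for every
  `λ` (`card_filter_le_rank_of_triangular` and the Landsberg–Ottaviani bound
  `rank_koszulFlattening_le_choose_mul_algBorderRank`), and `LandsbergMichalek2018_partTwo_young` —
  **`w ((2p+1) C(2p,p) − C(p+m, m−1)) ≤ C(2p,p) R̲(T^λ)`** for Young diagrams with `1 ≤ m ≤ p` cells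
  (`sum_lmCell_choose_le`), i.e. LM18's `R̲(M^λ_{⟨n,n,w⟩}) ≥ (2n−1)w − w C(n−1+m,m−1)/C(2n−2,n−1)`.

## References

* J. M. Landsberg, M. Michałek, *A `2n² − log₂(n) − 1` lower bound for the border rank of matrix
  multiplication*, IMRN 2018 (15) 4722–4733 = arXiv:1608.07486 (held: paper:arxiv-1608.07486,
  chunks 5–6): Thm. 1.1, §3 Part 2. [LandsbergMichalek2018]
* J. M. Landsberg, M. Michałek, *On the geometry of border rank algorithms for matrix multiplication
  and other tensors with symmetry*, SIAM J. Appl. Algebra Geom. 1 (2017) = arXiv:1601.08229 (held: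
  paper:arxiv-1601.08229, chunk 13): §6, proof of Thm. 6.1 (the order and the triangularity).
  [LandsbergMichalek2016Symmetry]
* J. M. Landsberg, G. Ottaviani, Theory of Computing 11 (2015), Thm. 2.1 (Koszul flattenings bound
  the border rank; in tree: `KoszulFlatteningBorderRank.lean`). [LandsbergOttaviani2015]
-/

noncomputable section

open scoped BigOperators Polynomial
open Matrix

namespace Literature.Computability.AlgebraicComplexity

/-! ## Deleting slices; the Landsberg–Michałek projection -/

section Defs

variable (K : Type*) [CommRing K]

/-- The tensor `t` with the slices `t(a, ·, ·)`, `a ∈ λ`, replaced by zero (the image of `t` in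
`(A/U_λ) ⊗ B ⊗ C`, `U_λ = span{e_a : a ∈ λ}`, extended by zero; LM18 §3, `M^λ := M/U_λ`).
[cite: LandsbergMichalek2018, §3 (notation U_λ, M^λ)] -/
def delSlices {K : Type*} [Zero K] {ι κ μ : Type*} (D : Finset ι) [DecidableEq ι]
    (t : ι → κ → μ → K) : ι → κ → μ → K :=
  fun a b c => if a ∈ D then 0 else t a b c

/-- The index `rev x + y ∈ {0, …, 2p}` of the basis vector `e_{rev x + y}` to which the
Landsberg–Michałek projection `A = U^* ⊗ V → ℂ^{2n-1}`, `u^i ⊗ v_j ↦ e_{i+j-1}` sends the cell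
`(x, y)` (first coordinate reversed so that the Young-diagram corner is `(0,0)`).
[cite: LandsbergMichalek2018, §3 (the map φ)] -/
def lmIdx (p : ℕ) (a : Fin (p + 1) × Fin (p + 1)) : Fin (2 * p + 1) :=
  ⟨(p - a.1) + a.2, by have := a.1.2; have := a.2.2; omega⟩

/-- The matrix of the Landsberg–Michałek projection `φ : K^{(p+1)×(p+1)} → K^{2p+1}`,
`e_{(x,y)} ↦ e_{rev x + y}`. [cite: LandsbergMichalek2018, §3 (the map φ)] -/
def lmMatrix (p : ℕ) : Matrix (Fin (2 * p + 1)) (Fin (p + 1) × Fin (p + 1)) K :=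
  Matrix.of fun r a => if lmIdx p a = r then 1 else 0

end Defs

section Entries

variable {K : Type*} [CommRing K]

/-- The value of `lmIdx`: `rev x + y = p − x + y`. [cite: LandsbergMichalek2018, §3 (the map φ)] -/
@[simp] theorem lmIdx_val (p : ℕ) (a : Fin (p + 1) × Fin (p + 1)) :
    (lmIdx p a : ℕ) = p - a.1 + a.2 := rfl

/-- Unfolding lemma for `delSlices`. [cite: LandsbergMichalek2018, §3 (notation M^λ)] -/
theorem delSlices_apply {ι κ μ : Type*} [DecidableEq ι] (D : Finset ι) (t : ι → κ → μ → K)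
    (a : ι) (b : κ) (c : μ) : delSlices D t a b c = if a ∈ D then 0 else t a b c := rfl

/-- Deleting no slice does nothing: `t^∅ = t`. [cite: LandsbergMichalek2018, §3 (notation M^λ)] -/
@[simp] theorem delSlices_empty {ι κ μ : Type*} [DecidableEq ι] (t : ι → κ → μ → K) :
    delSlices ∅ t = t := by
  funext a b c; simp [delSlices_apply]

/-- The LM projection on basis vectors: `φ(e_{(x,y)}) = e_{rev x + y}`.
[cite: LandsbergMichalek2018, §3 (the map φ)] -/
theorem lmMatrix_mulVec_single (p : ℕ) (a : Fin (p + 1) × Fin (p + 1)) (c : K) :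
    (lmMatrix K p).mulVecLin (Pi.single a c) = Pi.single (lmIdx p a) c := by
  ext r
  simp only [Matrix.mulVecLin_apply, Matrix.mulVec_single, Pi.smul_apply, Matrix.col_apply,
    op_smul_eq_mul, lmMatrix, Matrix.of_apply]
  by_cases h : lmIdx p a = r
  · subst h; simp
  · rw [if_neg h, Pi.single_eq_of_ne (Ne.symm h)]; simp

/-- Wedging with a multiple of a basis vector: `(c e_j) ∧ e_S = ε(S,j) c e_{S ∪ {j}}` for `j ∉ S`.
[folklore] -/
theorem wedgeMatrix_single {q : ℕ} (j : Fin q) (c : K) (T S : Finset (Fin q)) :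
    wedgeMatrix (Pi.single j c) T S =
      if j ∉ S ∧ T = insert j S then (koszulSign S j : K) * c else 0 := by
  rw [wedgeMatrix_apply, Finset.sum_eq_single j]
  · simp
  · intro j' _ hj'
    rw [Pi.single_eq_of_ne hj']; simp
  · simp

/-- The slices of `⟨p+1, w, p+1⟩^λ` in the first factor. [cite: LandsbergMichalek2018, §3] -/
theorem delSlices_matMulTensor_slice (p w : ℕ) (D : Finset (Fin (p + 1) × Fin (p + 1)))
    (κ : Fin (p + 1)) (k : Fin w) (k' : Fin w) (ν : Fin (p + 1)) :
    (fun a => delSlices D (matMulTensor K (p + 1) w (p + 1)) a (κ, k) (k', ν)) =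
      if k = k' ∧ (κ, ν) ∉ D then Pi.single (κ, ν) 1 else 0 := by
  funext a
  simp only [delSlices_apply, matMulTensor]
  by_cases hk : k = k'
  · subst hk
    by_cases hmem : (κ, ν) ∈ D
    · simp only [hmem, not_true_eq_false, and_false, ↓reduceIte, Pi.zero_apply]
      split_ifs with h1 h2
      · rfl
      · exfalso; obtain ⟨h2, -, h3⟩ := h2
        exact h1 (by rwa [show a = (κ, ν) from Prod.ext h2 h3])
      · rfl
    · simp only [hmem, not_false_eq_true, and_self, ↓reduceIte]
      by_cases ha : a = (κ, ν)
      · subst ha; simp [hmem]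
      · rw [Pi.single_eq_of_ne ha]
        split_ifs with h1 h2
        · rfl
        · exact absurd (Prod.ext h2.1 h2.2.2) ha
        · rfl
  · simp only [hk, false_and, ↓reduceIte, Pi.zero_apply]
    split_ifs <;> simp_all

/-- **Entries of the Koszul flattening of `⟨p+1, w, p+1⟩^λ` after the LM projection**: row
`(T, (k', ν))`, column `(S, (κ, k))`, entry `[k = k'] [(κ,ν) ∉ λ] (e_{rev κ + ν} ∧ e_S)_T`.
[cite: LandsbergMichalek2018, §3 (the reduced Koszul flattening e_S ⊗ v_η ↦ Σ_j e_{j+η-1} ∧ e_S ⊗ u_j)] -/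
theorem koszulFlattening_lm_apply (p w : ℕ) (D : Finset (Fin (p + 1) × Fin (p + 1)))
    (T : PSub (2 * p + 1) (p + 1)) (k' : Fin w) (ν : Fin (p + 1))
    (S : PSub (2 * p + 1) p) (κ : Fin (p + 1)) (k : Fin w) :
    koszulFlattening p (lmMatrix K p).mulVecLin
        (delSlices D (matMulTensor K (p + 1) w (p + 1))) (T, (k', ν)) (S, (κ, k)) =
      if k = k' ∧ (κ, ν) ∉ D ∧ lmIdx p (κ, ν) ∉ S.1 ∧ T.1 = insert (lmIdx p (κ, ν)) S.1 then
        (koszulSign S.1 (lmIdx p (κ, ν)) : K) else 0 := by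
  rw [koszulFlattening_apply]
  simp only
  rw [delSlices_matMulTensor_slice]
  by_cases h : k = k' ∧ (κ, ν) ∉ D
  · rw [if_pos h, lmMatrix_mulVec_single, wedgeMatrix_single]
    simp only [mul_one]
    by_cases h' : lmIdx p (κ, ν) ∉ S.1 ∧ T.1 = insert (lmIdx p (κ, ν)) S.1
    · rw [if_pos h', if_pos ⟨h.1, h.2, h'.1, h'.2⟩]
    · rw [if_neg h', if_neg]; tauto
  · rw [if_neg h, map_zero, wedgeMatrix_zero, if_neg]
    · rfl
    · tauto

end Entries


/-! ## The triangular structure of the reduced Koszul flattening (LM16 §6) -/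

section Pivot

variable {p : ℕ}

/-- `v(T, ν)`: the element of rank `ν` (the `(ν+1)`-st smallest element) of the `(p+1)`-subset `T`
of `{0, …, 2p}` — the `p_l` of LM16/LM18 (`P = (p_1 < ⋯ < p_n)`). [cite: LandsbergMichalek2018, §3] -/
def lmPivot (T : PSub (2 * p + 1) (p + 1)) (ν : Fin (p + 1)) : Fin (2 * p + 1) :=
  T.1.orderEmbOfFin T.2 ν

/-- `v(T, ν) ∈ T`. [folklore] -/
theorem lmPivot_mem (T : PSub (2 * p + 1) (p + 1)) (ν : Fin (p + 1)) : lmPivot T ν ∈ T.1 :=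
  Finset.orderEmbOfFin_mem _ _ _

/-- Exactly `ν` elements of `T` lie below `v(T, ν)`. [folklore] -/
theorem card_filter_lt_lmPivot (T : PSub (2 * p + 1) (p + 1)) (ν : Fin (p + 1)) :
    (T.1.filter (· < lmPivot T ν)).card = ν :=
  card_filter_lt_orderEmbOfFin _ _ _

/-- `ν ≤ v(T, ν)`. [folklore] -/
theorem le_lmPivot (T : PSub (2 * p + 1) (p + 1)) (ν : Fin (p + 1)) : (ν : ℕ) ≤ lmPivot T ν :=
  le_orderEmbOfFin _ _ _

/-- `v(T, ν) ≤ p + ν` (there are `p − ν` elements of `T` above it in `{0,…,2p}`). [folklore] -/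
theorem lmPivot_le (T : PSub (2 * p + 1) (p + 1)) (ν : Fin (p + 1)) :
    (lmPivot T ν : ℕ) ≤ p + ν := by
  have := orderEmbOfFin_le T.1 T.2 ν
  unfold lmPivot
  omega

/-- `ν ↦ v(T, ν)` is strictly increasing. [folklore] -/
theorem lmPivot_lt_lmPivot {T : PSub (2 * p + 1) (p + 1)} {i j : Fin (p + 1)} :
    lmPivot T i < lmPivot T j ↔ i < j :=
  (T.1.orderEmbOfFin T.2).lt_iff_lt

/-- `ν ↦ v(T, ν)` is injective. [folklore] -/
theorem lmPivot_injective (T : PSub (2 * p + 1) (p + 1)) : Function.Injective (lmPivot T) :=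
  (T.1.orderEmbOfFin T.2).injective

/-- `v(T, i) + (j − i) ≤ v(T, j)` for `i ≤ j`. [folklore] -/
theorem lmPivot_add_le (T : PSub (2 * p + 1) (p + 1)) {i j : Fin (p + 1)} (hij : i ≤ j) :
    (lmPivot T i : ℕ) + (j - i) ≤ lmPivot T j :=
  orderEmbOfFin_add_le _ _ hij

/-- Every element of `T` is some `v(T, i)`. [folklore] -/
theorem exists_lmPivot_eq (T : PSub (2 * p + 1) (p + 1)) {x : Fin (2 * p + 1)} (hx : x ∈ T.1) :
    ∃ i, lmPivot T i = x := by
  have : x ∈ Set.range (T.1.orderEmbOfFin T.2) := by rw [Finset.range_orderEmbOfFin]; exact hx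
  exact this

/-- An element of `T` with exactly `ν` elements of `T` below it is `v(T, ν)`. [folklore] -/
theorem lmPivot_eq_of_card_filter_lt (T : PSub (2 * p + 1) (p + 1)) (ν : Fin (p + 1))
    {x : Fin (2 * p + 1)} (hx : x ∈ T.1) (hcard : (T.1.filter (· < x)).card = ν) :
    lmPivot T ν = x :=
  orderEmbOfFin_eq_of_card_filter_lt _ _ _ hx hcard

/-- The first-factor cell `(p + ν - v, ·)` of the column matched to a row with pivot `v = v(T,ν)`.
[cite: LandsbergMichalek2018, §3 (the image of (P∖{p_l}, 1+p_l-l))] -/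
def lmColCell (T : PSub (2 * p + 1) (p + 1)) (ν : Fin (p + 1)) : Fin (p + 1) :=
  ⟨p + ν - lmPivot T ν, by have := le_lmPivot T ν; omega⟩

/-- The LM index of the cell `(p + ν − v, ν')` is `v − ν + ν'`. [cite: LandsbergMichalek2018, §3] -/
theorem lmIdx_lmColCell_val (T : PSub (2 * p + 1) (p + 1)) (ν ν' : Fin (p + 1)) :
    (lmIdx p (lmColCell T ν, ν') : ℕ) = lmPivot T ν - ν + ν' := by
  simp only [lmIdx_val, lmColCell]
  have := le_lmPivot T ν; have := lmPivot_le T ν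
  omega

/-- The LM index of the matched cell `(p + ν − v, ν)` is the pivot `v` itself
(LM16: "taking `m = l` we see `(P, l)` is among the summands"). [cite: LandsbergMichalek2018, §3] -/
theorem lmIdx_lmColCell_self (T : PSub (2 * p + 1) (p + 1)) (ν : Fin (p + 1)) :
    lmIdx p (lmColCell T ν, ν) = lmPivot T ν := by
  apply Fin.ext
  rw [lmIdx_lmColCell_val]
  have := le_lmPivot T ν
  omega

/-- `T ∖ {v(T,ν)}` as a `p`-subset. [cite: LandsbergMichalek2018, §3] -/
def lmErase (T : PSub (2 * p + 1) (p + 1)) (ν : Fin (p + 1)) : PSub (2 * p + 1) p :=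
  ⟨T.1.erase (lmPivot T ν), by rw [Finset.card_erase_of_mem (lmPivot_mem T ν), T.2]; rfl⟩

/-- The column `σ(T, (k', ν)) = (T ∖ {v}, ((p + ν - v), k'))` matched to the row `(T, (k', ν))`
(LM16: "consider the image of `(P ∖ {p_l}, 1 + p_l - l)`"). [cite: LandsbergMichalek2018, §3] -/
def lmCol {w : ℕ} (r : PSub (2 * p + 1) (p + 1) × (Fin w × Fin (p + 1))) :
    PSub (2 * p + 1) p × (Fin (p + 1) × Fin w) :=
  (lmErase r.1 r.2.2, (lmColCell r.1 r.2.2, r.2.1))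

/-- The Landsberg–Michałek order on target basis vectors, as a key in `Lex (Fin (p+1) → ℕ)`:
`(P, l) ↦ (p_1, …, p_l, ∞, …, ∞)`; `(P₁,l₁) < (P₂,l₂)` in LM16 iff `key(P₁,l₁) >_lex key(P₂,l₂)`.
[cite: LandsbergMichalek2018, §3 (the order on the target basis)] -/
def lmKey {w : ℕ} (r : PSub (2 * p + 1) (p + 1) × (Fin w × Fin (p + 1))) : Lex (Fin (p + 1) → ℕ) :=
  toLex fun i => if i ≤ r.2.2 then (lmPivot r.1 i : ℕ) else 2 * p + 1

/-- Unfolding lemma for `lmKey`. [cite: LandsbergMichalek2018, §3 (the order on the target basis)] -/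
theorem lmKey_apply {w : ℕ} (r : PSub (2 * p + 1) (p + 1) × (Fin w × Fin (p + 1))) (i : Fin (p + 1)) :
    ofLex (lmKey r) i = if i ≤ r.2.2 then (lmPivot r.1 i : ℕ) else 2 * p + 1 := rfl

/-- The lexicographic comparison of keys, unfolded. [cite: LandsbergMichalek2018, §3 (the order on the target basis)] -/
theorem lmKey_lt_iff {w : ℕ} (r r' : PSub (2 * p + 1) (p + 1) × (Fin w × Fin (p + 1))) :
    lmKey r < lmKey r' ↔ ∃ i, (∀ j < i, ofLex (lmKey r) j = ofLex (lmKey r') j) ∧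
      ofLex (lmKey r) i < ofLex (lmKey r') i := Iff.rfl

end Pivot


section Triangular

variable {K : Type*} [Field K] {p w : ℕ}

/-- Pivots of `T` below `v = v(T,ν)` remain pivots of `T' = (T ∖ {v}) ∪ {j}` when `j` lies above them.
[cite: LandsbergMichalek2018, §3] -/
theorem lmPivot_insert_erase_eq (T T' : PSub (2 * p + 1) (p + 1)) (ν : Fin (p + 1))
    {jj : Fin (2 * p + 1)} (hT' : T'.1 = insert jj (T.1.erase (lmPivot T ν))) {i : Fin (p + 1)}
    (hi : i < ν) (hjj : lmPivot T i < jj) : lmPivot T' i = lmPivot T i := by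
  apply lmPivot_eq_of_card_filter_lt
  · rw [hT']
    refine Finset.mem_insert_of_mem (Finset.mem_erase.2 ⟨?_, lmPivot_mem T i⟩)
    exact (lmPivot_lt_lmPivot.2 hi).ne
  · rw [hT', Finset.filter_insert, if_neg (not_lt.2 hjj.le), Finset.filter_erase,
      Finset.erase_eq_of_notMem, card_filter_lt_lmPivot]
    simp only [Finset.mem_filter, not_and, not_lt]
    intro _; exact (lmPivot_lt_lmPivot.2 hi).le

/-- **Triangularity of the reduced Koszul flattening** (LM16, proof of Thm. 6.1, last paragraph;
quoted in LM18 §3: "the image of `(P ∖ {p_l}, 1 + p_l − l)` is `± (P, l)` plus smaller terms in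
the order"): every non-zero entry of the column `σ(r)` lies in the row `r` or in a row of strictly
larger key. Deleting slices (`λ`) only removes entries, so this holds for every `λ`.
[cite: LandsbergMichalek2018, §3] -/
theorem lm_triangular (D : Finset (Fin (p + 1) × Fin (p + 1)))
    (r r' : PSub (2 * p + 1) (p + 1) × (Fin w × Fin (p + 1)))
    (h : koszulFlattening p (lmMatrix K p).mulVecLin
        (delSlices D (matMulTensor K (p + 1) w (p + 1))) r' (lmCol r) ≠ 0) :
    r' = r ∨ lmKey r < lmKey r' := by
  obtain ⟨T, k', ν⟩ := r
  obtain ⟨T', k'', ν'⟩ := r'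
  simp only [lmCol] at h
  rw [koszulFlattening_lm_apply] at h
  by_cases hc : k' = k'' ∧ (lmColCell T ν, ν') ∉ D ∧
      lmIdx p (lmColCell T ν, ν') ∉ (lmErase T ν).1 ∧
      T'.1 = insert (lmIdx p (lmColCell T ν, ν')) (lmErase T ν).1
  swap
  · exact absurd (if_neg hc) h
  obtain ⟨hk, -, hjS, hT'⟩ := hc
  subst hk
  have hjjval : (lmIdx p (lmColCell T ν, ν') : ℕ) = lmPivot T ν - ν + ν' :=
    lmIdx_lmColCell_val T ν ν'
  have hνv : (ν : ℕ) ≤ lmPivot T ν := le_lmPivot T ν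
  simp only [lmErase] at hjS hT'
  rcases lt_trichotomy ν' ν with hlt | heq | hgt
  · -- `ν' < ν`: the row `r'` shares its first `ν'+1` pivots with `r` and then jumps to `∞`
    right
    have hlt' : (ν' : ℕ) < ν := hlt
    have hjjlt : (lmIdx p (lmColCell T ν, ν') : ℕ) < lmPivot T ν := by omega
    have hadd := lmPivot_add_le T hlt.le
    have hpiv' : lmPivot T ν' < lmIdx p (lmColCell T ν, ν') := by
      rw [Fin.lt_def]
      rcases (show (lmPivot T ν' : ℕ) ≤ lmIdx p (lmColCell T ν, ν') by omega).lt_or_eq with h1 | h1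
      · exact h1
      · exfalso
        apply hjS
        rw [← Fin.ext h1]
        exact Finset.mem_erase.2 ⟨fun h2 => by rw [h2] at h1; omega, lmPivot_mem T ν'⟩
    have hsame : ∀ i : Fin (p + 1), i ≤ ν' → lmPivot T' i = lmPivot T i := fun i hi =>
      lmPivot_insert_erase_eq T T' ν hT' (lt_of_le_of_lt hi hlt)
        (lt_of_le_of_lt ((OrderEmbedding.le_iff_le _).2 hi) hpiv')
    refine (lmKey_lt_iff _ _).2 ⟨⟨ν' + 1, by omega⟩, fun j hj => ?_, ?_⟩
    · have hj' : j ≤ ν' := by rw [Fin.lt_def] at hj; rw [Fin.le_def]; simpa using hj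
      rw [lmKey_apply, lmKey_apply, if_pos (show j ≤ ν from hj'.trans hlt.le), if_pos hj', hsame j hj']
    · rw [lmKey_apply, lmKey_apply, if_pos (show (⟨ν' + 1, _⟩ : Fin (p + 1)) ≤ ν from ?_),
        if_neg (show ¬ (⟨ν' + 1, _⟩ : Fin (p + 1)) ≤ ν' from ?_)]
      · exact (lmPivot T _).2
      · rw [Fin.le_def]; simp
      · rw [Fin.le_def]; exact hlt'
  · subst heq
    left
    have hjv : lmIdx p (lmColCell T ν', ν') = lmPivot T ν' := lmIdx_lmColCell_self T ν'
    rw [hjv, Finset.insert_erase (lmPivot_mem T ν')] at hT'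
    have : T' = T := Subtype.ext hT'
    subst this
    rfl
  · -- `ν < ν'`: the rows share the first `ν` pivots and the `ν`-th pivot of `r'` is larger
    right
    have hgt' : (ν : ℕ) < ν' := hgt
    have hjjgt : lmPivot T ν < lmIdx p (lmColCell T ν, ν') := by rw [Fin.lt_def]; omega
    have hsame : ∀ i : Fin (p + 1), i < ν → lmPivot T' i = lmPivot T i := fun i hi =>
      lmPivot_insert_erase_eq T T' ν hT' hi ((lmPivot_lt_lmPivot.2 hi).trans hjjgt)
    refine (lmKey_lt_iff _ _).2 ⟨ν, fun j hj => ?_, ?_⟩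
    · rw [lmKey_apply, lmKey_apply, if_pos hj.le, if_pos (hj.le.trans hgt.le), hsame j hj]
    · rw [lmKey_apply, lmKey_apply, if_pos le_rfl, if_pos hgt.le]
      simp only
      by_contra hle
      rw [not_lt] at hle
      have hx : lmPivot T' ν ∈ T'.1 := lmPivot_mem T' ν
      rw [hT', Finset.mem_insert, Finset.mem_erase] at hx
      rcases hx with hx | ⟨hxv, hxT⟩
      · rw [hx] at hle
        rw [Fin.lt_def] at hjjgt
        omega
      · obtain ⟨i, hi⟩ := exists_lmPivot_eq T hxT
        have hiν : i < ν := by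
          rw [← lmPivot_lt_lmPivot (T := T), hi, Fin.lt_def]
          exact lt_of_le_of_ne hle (fun h => hxv (Fin.ext h))
        have := hsame i hiν
        rw [hi] at this
        exact absurd (lmPivot_injective T' this) hiν.ne

/-- **Diagonal entries**: the entry of the row `r = (T, (k', ν))` in its own column `σ(r)` is
`± [(p + ν - v, ν) ∉ λ]` — it vanishes exactly when the matched first-factor cell was deleted
(LM18 §3: "`(P, l)` will not appear as the leading term any more if and only if …").
[cite: LandsbergMichalek2018, §3] -/
theorem lm_diag_ne_zero_iff (D : Finset (Fin (p + 1) × Fin (p + 1)))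
    (r : PSub (2 * p + 1) (p + 1) × (Fin w × Fin (p + 1))) :
    koszulFlattening p (lmMatrix K p).mulVecLin
        (delSlices D (matMulTensor K (p + 1) w (p + 1))) r (lmCol r) ≠ 0 ↔
      (lmColCell r.1 r.2.2, r.2.2) ∉ D := by
  obtain ⟨T, k', ν⟩ := r
  simp only [lmCol]
  rw [koszulFlattening_lm_apply, lmIdx_lmColCell_self]
  simp only [lmErase, true_and]
  have h1 : lmPivot T ν ∉ T.1.erase (lmPivot T ν) := Finset.notMem_erase _ _
  have h2 : T.1 = insert (lmPivot T ν) (T.1.erase (lmPivot T ν)) :=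
    (Finset.insert_erase (lmPivot_mem T ν)).symm
  constructor
  · intro h hD
    apply h
    rw [if_neg]
    tauto
  · intro hD
    rw [if_pos ⟨hD, h1, h2⟩]
    exact cast_koszulSign_ne_zero _ _

end Triangular


/-! ## Counting the vanishing diagonal entries -/

section Count

variable {p : ℕ}

/-- `g(x, y) = C(p − x + y, y) · C(p + x − y, x)`: the number of `(p+1)`-subsets of `{0,…,2p}` whose
element of rank `y` is `p + y − x` — the number of diagonal entries killed by deleting the cell
`(x, y)` (LM18 §3: `g(i,j) = C(n−i+j−1, j−1) C(n+i−j−1, i−1)`, here `0`-indexed, `n = p + 1`).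
[cite: LandsbergMichalek2018, §3 (the function g(i,j))] -/
def lmG (p : ℕ) (a : Fin (p + 1) × Fin (p + 1)) : ℕ :=
  (p - a.1 + a.2).choose a.2 * (p + a.1 - a.2).choose a.1

/-- If the matched cell of `(T, ν)` has first coordinate `x` then `v(T, ν) = p + ν − x`.
[cite: LandsbergMichalek2018, §3] -/
theorem lmPivot_val_of_lmColCell_eq (T : PSub (2 * p + 1) (p + 1)) (ν x : Fin (p + 1))
    (h : lmColCell T ν = x) : (lmPivot T ν : ℕ) = p + ν - x := by
  have h1 := le_lmPivot T ν
  have h2 := lmPivot_le T ν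
  have h3 : (lmColCell T ν : ℕ) = x := by rw [h]
  simp only [lmColCell] at h3
  omega

/-- A `(p+1)`-subset splits as (elements below its rank-`ν` element) ∪ {it} ∪ (elements above).
[folklore] -/
theorem PSub_eq_filter_union (T : PSub (2 * p + 1) (p + 1)) (ν : Fin (p + 1)) :
    T.1 = T.1.filter (· < lmPivot T ν) ∪ ({lmPivot T ν} ∪ T.1.filter (lmPivot T ν < ·)) := by
  ext z
  simp only [Finset.mem_union, Finset.mem_filter, Finset.mem_singleton]
  constructor
  · intro hz
    rcases lt_trichotomy z (lmPivot T ν) with h | h | h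
    · exact Or.inl ⟨hz, h⟩
    · exact Or.inr (Or.inl h)
    · exact Or.inr (Or.inr ⟨hz, h⟩)
  · rintro (⟨hz, -⟩ | rfl | ⟨hz, -⟩)
    · exact hz
    · exact lmPivot_mem T ν
    · exact hz

/-- Exactly `p − ν` elements of `T` lie above `v(T, ν)`. [folklore] -/
theorem card_filter_gt_lmPivot (T : PSub (2 * p + 1) (p + 1)) (ν : Fin (p + 1)) :
    (T.1.filter (lmPivot T ν < ·)).card = p - ν := by
  have hdisj1 : Disjoint ({lmPivot T ν} : Finset _) (T.1.filter (lmPivot T ν < ·)) := by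
    rw [Finset.disjoint_singleton_left]
    simp
  have hdisj2 : Disjoint (T.1.filter (· < lmPivot T ν))
      ({lmPivot T ν} ∪ T.1.filter (lmPivot T ν < ·)) := by
    rw [Finset.disjoint_left]
    intro z hz hz'
    simp only [Finset.mem_filter] at hz
    simp only [Finset.mem_union, Finset.mem_singleton, Finset.mem_filter] at hz'
    rcases hz' with rfl | ⟨-, h⟩
    · exact lt_irrefl _ hz.2
    · exact lt_asymm h hz.2
  have hcard := T.2
  rw [PSub_eq_filter_union T ν, Finset.card_union_of_disjoint hdisj2,
    Finset.card_union_of_disjoint hdisj1, card_filter_lt_lmPivot, Finset.card_singleton] at hcard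
  omega

/-- **The number of vanishing diagonal entries** is at most `w · Σ_{(x,y) ∈ λ} g(x,y)`: a row
`(T, (k', ν))` with vanishing diagonal entry determines the deleted cell `(p + ν − v, ν) ∈ λ`, and
for a fixed cell `(x, y)` the set `T` is recovered from `k'`, its `y` elements below `v = p + y − x`
and its `p − y` elements above. [cite: LandsbergMichalek2018, §3 (count of additional zeros on the diagonal)] -/
theorem card_filter_cell_mem_le (w : ℕ) (D : Finset (Fin (p + 1) × Fin (p + 1))) :
    (Finset.univ.filter fun r : PSub (2 * p + 1) (p + 1) × (Fin w × Fin (p + 1)) =>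
        (lmColCell r.1 r.2.2, r.2.2) ∈ D).card ≤ w * ∑ a ∈ D, lmG p a := by
  classical
  set cell : PSub (2 * p + 1) (p + 1) × (Fin w × Fin (p + 1)) → Fin (p + 1) × Fin (p + 1) :=
    fun r => (lmColCell r.1 r.2.2, r.2.2) with hcell
  set Z := Finset.univ.filter fun r : PSub (2 * p + 1) (p + 1) × (Fin w × Fin (p + 1)) =>
    cell r ∈ D with hZ
  have hmaps : ∀ r ∈ Z, cell r ∈ D := fun r hr => (Finset.mem_filter.1 hr).2
  rw [Finset.card_eq_sum_card_fiberwise hmaps, Finset.mul_sum]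
  refine Finset.sum_le_sum fun a ha => ?_
  -- the fibre over the cell `a = (x, y)`
  set v₀ : Fin (2 * p + 1) := ⟨p + a.2 - a.1, by have := a.2.2; omega⟩ with hv₀
  have hv₀val : (v₀ : ℕ) = p + a.2 - a.1 := rfl
  set tgt : Finset (Fin w × (Finset (Fin (2 * p + 1)) × Finset (Fin (2 * p + 1)))) :=
    Finset.univ ×ˢ ((Finset.Iio v₀).powersetCard a.2 ×ˢ (Finset.Ioi v₀).powersetCard (p - a.2))
    with htgt
  have htgt_card : tgt.card = w * lmG p a := by
    rw [htgt, Finset.card_product, Finset.card_product, Finset.card_powersetCard,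
      Finset.card_powersetCard, Fin.card_Iio, Fin.card_Ioi, Finset.card_univ, Fintype.card_fin, lmG]
    have hx := a.1.2; have hy := a.2.2
    congr 1
    rw [show (v₀ : ℕ) = p - a.1 + a.2 by rw [hv₀val]; omega,
      show 2 * p + 1 - 1 - (p - ↑a.1 + ↑a.2) = p + a.1 - a.2 by omega,
      show p - (a.2 : ℕ) = p + a.1 - a.2 - a.1 by omega, Nat.choose_symm (by omega)]
  rw [← htgt_card]
  refine Finset.card_le_card_of_injOn
    (fun r => (r.2.1, (r.1.1.filter (· < v₀), r.1.1.filter (v₀ < ·)))) ?_ ?_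
  · intro r hr
    simp only [Finset.coe_filter, Set.mem_setOf_eq] at hr
    obtain ⟨hrZ, hra⟩ := hr
    have hν : r.2.2 = a.2 := by rw [← hra]
    have hv : lmPivot r.1 r.2.2 = v₀ := by
      apply Fin.ext
      rw [lmPivot_val_of_lmColCell_eq r.1 r.2.2 a.1 (by rw [← hra]), hv₀val, hν]
    simp only [htgt, Finset.coe_product, Finset.coe_univ, Set.mem_prod, Set.mem_univ, true_and,
      Finset.mem_coe, Finset.mem_powersetCard]
    refine ⟨⟨fun z hz => ?_, ?_⟩, fun z hz => ?_, ?_⟩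
    · exact Finset.mem_Iio.2 (Finset.mem_filter.1 hz).2
    · rw [← hv, card_filter_lt_lmPivot, hν]
    · exact Finset.mem_Ioi.2 (Finset.mem_filter.1 hz).2
    · rw [← hv, card_filter_gt_lmPivot, hν]
  · intro r hr r' hr' heq
    simp only [Finset.coe_filter, Set.mem_setOf_eq] at hr hr'
    simp only [Prod.mk.injEq] at heq
    obtain ⟨hk, hlo, hhi⟩ := heq
    have hν : r.2.2 = r'.2.2 := by
      have h1 := congrArg Prod.snd hr.2
      have h2 := congrArg Prod.snd hr'.2
      simp only [hcell] at h1 h2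
      rw [h1, h2]
    have hv : lmPivot r.1 r.2.2 = v₀ := by
      apply Fin.ext
      rw [lmPivot_val_of_lmColCell_eq r.1 r.2.2 a.1 (by have := hr.2; rw [← this]), hv₀val,
        show r.2.2 = a.2 by have := hr.2; rw [← this]]
    have hv' : lmPivot r'.1 r'.2.2 = v₀ := by
      apply Fin.ext
      rw [lmPivot_val_of_lmColCell_eq r'.1 r'.2.2 a.1 (by have := hr'.2; rw [← this]), hv₀val,
        show r'.2.2 = a.2 by have := hr'.2; rw [← this]]
    have hT : r.1.1 = r'.1.1 := by
      rw [PSub_eq_filter_union r.1 r.2.2, PSub_eq_filter_union r'.1 r'.2.2, hv, hv', hlo, hhi]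
    exact Prod.ext (Subtype.ext hT) (Prod.ext hk hν)

end Count



/-! ## The binomial optimisation, in terms of `lmG` -/

section YoungBridge

variable {p : ℕ}

/-- `Σ_{(x,y) ∈ λ} g(x,y) ≤ C(p + m + 1, m)` for a Young diagram (lower set) `λ` with `m + 1 ≤ p`
cells (`LandsbergMichalekBinomial.sum_lmCell_choose_le`, restated for `lmG`).
[cite: LandsbergMichalek2018, §3 (f_λ ≤ C(n−1+m, m−1))] -/
theorem sum_lmG_le (m : ℕ) (D : Finset (Fin (p + 1) × Fin (p + 1)))
    (hD : IsLowerSet (D : Set (Fin (p + 1) × Fin (p + 1)))) (hcard : D.card = m + 1)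
    (hmp : m + 1 ≤ p) : ∑ a ∈ D, lmG p a ≤ (p + m + 1).choose m :=
  sum_lmCell_choose_le m D hD hcard hmp

end YoungBridge

/-! ## Part 2 of the proof of LM18 Thm. 1.1: the Koszul-flattening estimate for `⟨n, w, n⟩^λ` -/

section PartTwo

variable (K : Type*) [Field K]

/-- **The Koszul-flattening estimate for the reduced tensor** (LM18 §3, Part 2): for every set `λ`
of first-factor cells,
`w (p+1) C(2p+1, p+1) ≤ C(2p, p) · R̲(⟨p+1, w, p+1⟩^λ) + w Σ_{(x,y) ∈ λ} g(x,y)`: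
the Koszul flattening of `⟨p+1,w,p+1⟩^λ` after the LM projection has at least
`w (p+1) C(2p+1,p+1) − w Σ_λ g` non-zero "diagonal" entries in a triangular pattern
(`lm_triangular`, `lm_diag_ne_zero_iff`, `card_filter_cell_mem_le`), hence at least that rank
(`card_filter_le_rank_of_triangular`), and `rank ≤ C(2p,p) R̲` (Landsberg–Ottaviani,
`rank_koszulFlattening_le_choose_mul_algBorderRank`). Any field.
[cite: LandsbergMichalek2018, §3 (Part 2)] -/
theorem LandsbergMichalek2018_partTwo (p w : ℕ) (D : Finset (Fin (p + 1) × Fin (p + 1))) :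
    w * ((p + 1) * (2 * p + 1).choose (p + 1)) ≤
      (2 * p).choose p * algBorderRank (delSlices D (matMulTensor K (p + 1) w (p + 1))) +
        w * ∑ a ∈ D, lmG p a := by
  classical
  set N := koszulFlattening p (lmMatrix K p).mulVecLin
    (delSlices D (matMulTensor K (p + 1) w (p + 1))) with hNdef
  have hrank := rank_koszulFlattening_le_choose_mul_algBorderRank p (lmMatrix K p)
    (delSlices D (matMulTensor K (p + 1) w (p + 1)))
  rw [← hNdef] at hrank
  have htri := card_filter_le_rank_of_triangular N lmCol lmKey (fun r r' h => lm_triangular D r r' h)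
  have hzero : (Finset.univ.filter fun r : PSub (2 * p + 1) (p + 1) × (Fin w × Fin (p + 1)) =>
      ¬ N r (lmCol r) ≠ 0).card ≤ w * ∑ a ∈ D, lmG p a := by
    have : (Finset.univ.filter fun r : PSub (2 * p + 1) (p + 1) × (Fin w × Fin (p + 1)) =>
        ¬ N r (lmCol r) ≠ 0) =
        Finset.univ.filter fun r => (lmColCell r.1 r.2.2, r.2.2) ∈ D := by
      refine Finset.filter_congr fun r _ => ?_
      rw [hNdef, lm_diag_ne_zero_iff]
      tauto
    rw [this]
    exact card_filter_cell_mem_le w D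
  have hsplit := Finset.card_filter_add_card_filter_not
    (s := (Finset.univ : Finset (PSub (2 * p + 1) (p + 1) × (Fin w × Fin (p + 1)))))
    (p := fun r => N r (lmCol r) ≠ 0)
  have hcard : (Finset.univ : Finset (PSub (2 * p + 1) (p + 1) × (Fin w × Fin (p + 1)))).card =
      w * ((p + 1) * (2 * p + 1).choose (p + 1)) := by
    rw [Finset.card_univ, Fintype.card_prod, Fintype.card_prod, card_PSub, Fintype.card_fin,
      Fintype.card_fin]
    ring
  rw [hcard] at hsplit
  omega

/-- The same estimate for a Young diagram `λ` with `m` cells, `1 ≤ m ≤ p`, combined with the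
binomial optimisation `Σ_λ g ≤ C(p+m, m−1)` (`sum_lmG_le`):
`w ((2p+1) C(2p,p) − C(p+m, m−1)) ≤ C(2p,p) · R̲(⟨p+1, w, p+1⟩^λ)`, i.e. LM18's
"`R̲(M^λ_{⟨n,n,w⟩}) ≥ (2n−1) w − w C(n−1+m, m−1)/C(2n−2, n−1)`" with `n = p + 1`.
[cite: LandsbergMichalek2018, §3 (Part 2, the displayed bound for R̲(M^λ))] -/
theorem LandsbergMichalek2018_partTwo_young (p w m : ℕ) (D : Finset (Fin (p + 1) × Fin (p + 1)))
    (hD : IsLowerSet (D : Set (Fin (p + 1) × Fin (p + 1)))) (hcard : D.card = m) (h1 : 1 ≤ m)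
    (hmp : m ≤ p) :
    w * ((2 * p + 1) * (2 * p).choose p) ≤
      (2 * p).choose p * algBorderRank (delSlices D (matMulTensor K (p + 1) w (p + 1))) +
        w * (p + m).choose (m - 1) := by
  obtain ⟨m, rfl⟩ : ∃ m', m = m' + 1 := ⟨m - 1, by omega⟩
  have hsum := sum_lmG_le m D hD hcard hmp
  have h2 := LandsbergMichalek2018_partTwo K p w D
  have hid : (p + 1) * (2 * p + 1).choose (p + 1) = (2 * p + 1) * (2 * p).choose p := by
    rw [mul_comm]; exact (Nat.add_one_mul_choose_eq (2 * p) p).symm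
  rw [hid] at h2
  rw [show m + 1 - 1 = m from rfl, show p + (m + 1) = p + m + 1 by ring]
  have := Nat.mul_le_mul_left w hsum
  omega

end PartTwo

end Literature.Computability.AlgebraicComplexity

end
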